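import Mathlib
import Summits.Ventures.PercRepro.PuncturedLYMTriplesAllkTable

/-!
# PercRepro — (SP) FOR ANY NUMBER OF PAIRWISE DISJOINT TRIPLES AT LEVEL 4: THE ROW IDENTITIES
(p10, gen 40)

For each of the nine row classes `(c1, c2)` (`t = c1 + c2` touched members, `4 − c1 − 2c2` free points): the `3(k − t)`
new-member directions at the weight `raw … 0`, the `2 c1` directions into a member met once at `raw … 1`, the `c2`
member columns at `1/3`, and the `n − 3k − (4 − c1 − 2c2)` free directions at `raw … 3` add up to `#Y / #P = Yc / Pc`,
as an identity of rational functions in `(n, k)` (denominators `Qp`, `Pp`, `Pc` nonzero).  Nothing here asserts (SP).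
-/

namespace PercRepro.PuncturedLYM.Split.TypeLift.TriplesAllK

/-- The row identity of the class `(0, 0)`. -/
theorem row_0_0 (n k : ℚ) (hQ : Qp n k ≠ 0) (hP : Pp n k ≠ 0) (hPc : Pc n k ≠ 0) :
    3 * (k - 0) * raw n k 0 0 0 + (n - 3 * k - 4) * raw n k 0 0 3 = Yc n / Pc n k := by
  simp (config := {decide := true}) only [raw, sel, if_true, if_false]
  field_simp
  unfold Qp Pp Yc Pc N0n N0f
  ring

/-- The row identity of the class `(1, 0)`. -/
theorem row_1_0 (n k : ℚ) (hQ : Qp n k ≠ 0) (hP : Pp n k ≠ 0) (hPc : Pc n k ≠ 0) :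
    3 * (k - 1) * raw n k 1 0 0 + 2 * 1 * raw n k 1 0 1 + (n - 3 * k - 3) * raw n k 1 0 3 = Yc n / Pc n k := by
  simp (config := {decide := true}) only [raw, sel, if_true, if_false]
  field_simp
  unfold Qp Pp Yc Pc N1n N1s N1f
  ring

/-- The row identity of the class `(0, 1)`. -/
theorem row_0_1 (n k : ℚ) (hQ : Qp n k ≠ 0) (hP : Pp n k ≠ 0) (hPc : Pc n k ≠ 0) :
    3 * (k - 1) * raw n k 0 1 0 + 1 / 3 + (n - 3 * k - 2) * raw n k 0 1 3 = Yc n / Pc n k := by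
  simp (config := {decide := true}) only [raw, sel, if_true, if_false]
  field_simp
  unfold Qp Pp Yc Pc N2n N2f
  ring

/-- The row identity of the class `(2, 0)`. -/
theorem row_2_0 (n k : ℚ) (hQ : Qp n k ≠ 0) (hP : Pp n k ≠ 0) (hPc : Pc n k ≠ 0) :
    3 * (k - 2) * raw n k 2 0 0 + 2 * 2 * raw n k 2 0 1 + (n - 3 * k - 2) * raw n k 2 0 3 = Yc n / Pc n k := by
  simp (config := {decide := true}) only [raw, sel, if_true, if_false]
  field_simp
  unfold Qp Pp Yc Pc N11n N11s N11f
  ring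

/-- The row identity of the class `(1, 1)`. -/
theorem row_1_1 (n k : ℚ) (hQ : Qp n k ≠ 0) (hP : Pp n k ≠ 0) (hPc : Pc n k ≠ 0) :
    3 * (k - 2) * raw n k 1 1 0 + 2 * 1 * raw n k 1 1 1 + 1 / 3 + (n - 3 * k - 1) * raw n k 1 1 3 = Yc n / Pc n k := by
  simp (config := {decide := true}) only [raw, sel, if_true, if_false]
  field_simp
  unfold Qp Pp Yc Pc N21n N21s N21f
  ring

/-- The row identity of the class `(3, 0)`. -/
theorem row_3_0 (n k : ℚ) (hQ : Qp n k ≠ 0) (hP : Pp n k ≠ 0) (hPc : Pc n k ≠ 0) :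
    3 * (k - 3) * raw n k 3 0 0 + 2 * 3 * raw n k 3 0 1 + (n - 3 * k - 1) * raw n k 3 0 3 = Yc n / Pc n k := by
  simp (config := {decide := true}) only [raw, sel, if_true, if_false]
  field_simp
  unfold Qp Pp Yc Pc N111n N111s N111f
  ring

/-- The row identity of the class `(0, 2)`. -/
theorem row_0_2 (n k : ℚ) (hQ : Qp n k ≠ 0) (hP : Pp n k ≠ 0) (hPc : Pc n k ≠ 0) :
    3 * (k - 2) * raw n k 0 2 0 + 2 / 3 + (n - 3 * k - 0) * raw n k 0 2 3 = Yc n / Pc n k := by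
  simp (config := {decide := true}) only [raw, sel, if_true, if_false]
  field_simp
  unfold Qp Pp Yc Pc N22n N22f
  ring

/-- The row identity of the class `(2, 1)`. -/
theorem row_2_1 (n k : ℚ) (hQ : Qp n k ≠ 0) (hP : Pp n k ≠ 0) (hPc : Pc n k ≠ 0) :
    3 * (k - 3) * raw n k 2 1 0 + 2 * 2 * raw n k 2 1 1 + 1 / 3 + (n - 3 * k - 0) * raw n k 2 1 3 = Yc n / Pc n k := by
  simp (config := {decide := true}) only [raw, sel, if_true, if_false]
  field_simp
  unfold Qp Pp Yc Pc N211n N211s N211f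
  ring

/-- The row identity of the class `(4, 0)`. -/
theorem row_4_0 (n k : ℚ) (hQ : Qp n k ≠ 0) (hP : Pp n k ≠ 0) (hPc : Pc n k ≠ 0) :
    3 * (k - 4) * raw n k 4 0 0 + 2 * 4 * raw n k 4 0 1 + (n - 3 * k - 0) * raw n k 4 0 3 = Yc n / Pc n k := by
  simp (config := {decide := true}) only [raw, sel, if_true, if_false]
  field_simp
  unfold Qp Pp Yc Pc N1111n N1111s N1111f
  ring

/-- The row identity of every class `(c1, c2)` with `c1 + 2 c2 ≤ 4`, in one statement. -/
theorem row_check (n k : ℚ) (hQ : Qp n k ≠ 0) (hP : Pp n k ≠ 0) (hPc : Pc n k ≠ 0) (c1 c2 : ℕ)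
    (h : c1 + 2 * c2 ≤ 4) :
    3 * (k - ((c1 : ℚ) + c2)) * raw n k c1 c2 0 + 2 * (c1 : ℚ) * raw n k c1 c2 1 + (c2 : ℚ) / 3 +
      (n - 3 * k - ((4 : ℚ) - c1 - 2 * c2)) * raw n k c1 c2 3 = Yc n / Pc n k := by
  have h1 : c1 ≤ 4 := by omega
  have h2 : c2 ≤ 2 := by omega
  interval_cases c1 <;> interval_cases c2 <;> push_cast
  · linear_combination row_0_0 n k hQ hP hPc
  · linear_combination row_0_1 n k hQ hP hPc
  · linear_combination row_0_2 n k hQ hP hPc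
  · linear_combination row_1_0 n k hQ hP hPc
  · linear_combination row_1_1 n k hQ hP hPc
  · omega
  · linear_combination row_2_0 n k hQ hP hPc
  · linear_combination row_2_1 n k hQ hP hPc
  · omega
  · linear_combination row_3_0 n k hQ hP hPc
  · omega
  · omega
  · linear_combination row_4_0 n k hQ hP hPc
  · omega
  · omega

end PercRepro.PuncturedLYM.Split.TypeLift.TriplesAllK
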